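import Literature.Analysis.FluidPDE.CheskidovShvydkoyApriori
import HarnessLib

/-!
# The `H¹` a-priori estimate with a LOW-MODE rate (Cheskidov–Dai): the two-point inequality

Analysis/FluidPDE support file (serves the discharge of the named fact
`Literature.Analysis.FluidPDE.cheskidov_dai_occupation_regular` — Cheskidov–Dai, arXiv:1507.06611 =
Proc. Edinburgh Math. Soc. (2025), Thm. 1.1). §3.1 of the paper turns the low-mode bound (3.6) on the flux
into the differential inequality (3.8) `d/dt ‖u‖²_{H^s} ≤ C f(t) ‖u‖²_{H^s}`, `f(t) = ∑_{q ≤ Q(t)} λ_q‖u_q‖_∞`,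
and integrates it: "by Grönwall's inequality, `‖u(t)‖²_{H^s} ≤ exp(∫_{T/2}^t C f(τ) dτ) ‖u(T/2)‖²_{H^s}`".
The rate `f` is TIME-DEPENDENT through the cut `Q(t)` (the dissipation wavenumber), and no measurability
of `t ↦ Q(t)` is available or needed: this file proves, in the tree's `H¹` dyadic language
(`CheskidovShvydkoyApriori`: smooth slab solutions, `dyadicF`, `truncDissip`),

* `weighted_integrand_le_lowMode` — the pointwise bound on the weighted balance integrand: GIVEN a
  low-mode bound `∑_{|j|≤L} 4^j ‖N_j‖ ≤ B_f f_J F + B_κ κ D₄` for the slice (the output of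
  `CheskidovDaiWeightedSum.lean`, taken here as a hypothesis so that this file is independent of it) and
  the smallness `B_κ κ C_r² d ≤ ν`, the dissipation absorbs the high part:
  `∑_{|j|≤L} 4^j (-ν ∑_i ‖∂_i Δ̇_j u‖² - N_j) ≤ tail_L + B_f f_J F`;
* `IsSmoothSlabSolution.dyadicF_two_point_lowMode` — the integrated form along a smooth slab with a
  time-dependent cut `J(τ)`: `F(t) ≤ F(s) + 2 B_f (∫⁻_{(s,t]} f_{J(τ)}(τ) dτ) · sup_{[s,t]} F`, the time
  integral being the LOWER Lebesgue integral (monotone in the integrand, additive in the interval, no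
  measurability required).

(The variable-rate Grönwall step is `CheskidovDaiGronwall.le_two_mul_rpow_of_two_point`; the two are
combined along covered intervals in `CheskidovDaiCovered.lean`.)

## References

* A. Cheskidov, M. Dai, arXiv:1507.06611 = Proc. Edinburgh Math. Soc. (2025), §3.1, (3.8) and the
  Grönwall step. [CheskidovDai2015]
-/

noncomputable section

open MeasureTheory Filter Topology Function Set
open Literature.Analysis.FunctionSpaces
open scoped ENNReal NNReal RealInnerProductSpace

namespace Literature.Analysis.FluidPDE

/-! ## The pointwise bound on the weighted balance integrand with a low-mode rate -/

section SliceBound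

open LPBounds

variable {ι : Type*} [Fintype ι] (K : LPBounds ι)

/-- `D₄ ≤ C_r² D`: the dyadic `16^l`-weighted energy `∑_l (4^l ‖Δ̇_l v‖₂)²` against the dyadic dissipation
(reverse Bernstein `2^l a_l ≤ C_r g_l`). [cite: CheskidovDai2015, §3.1 (3.6)] -/
theorem dyadicSqSum_four_le_dyadicD {v : EuclideanSpace ℝ ι → EuclideanSpace ℝ ι} (hv : IsSmoothL2Field v) :
    dyadicSqSum (fun l => (2 : ℝ≥0∞) ^ l * blockL2 v l) ≤ (K.Cr : ℝ≥0∞) ^ 2 * dyadicD v := by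
  unfold dyadicD dyadicSqSum
  rw [← ENNReal.tsum_mul_left]
  refine ENNReal.tsum_le_tsum fun l => ?_
  set P := (2 : ℝ≥0∞) ^ l with hP
  calc (P * (P * blockL2 v l)) ^ 2 ≤ (P * (K.Cr * blockGrad v l)) ^ 2 :=
        pow_le_pow_left' (mul_le_mul_right (K.two_zpow_mul_blockL2_le hv l) _) 2
    _ = (K.Cr : ℝ≥0∞) ^ 2 * (P * blockGrad v l) ^ 2 := by ring

/-- **The pointwise bound on the weighted balance integrand, low-mode form** (Cheskidov–Dai (3.8):
`d/dt ∑_q λ_q^{2s}‖u_q‖₂² ≤ -ν ∑ λ_q^{2s+2}‖u_q‖₂² + C c_r ν ∑_{q>Q-3} λ_q^{2s+2}‖u_q‖₂² + C f(t) ∑ λ_q^{2s}‖u_q‖₂²`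
"for `c_r` small enough"). GIVEN the low-mode bound on the weighted nonlinear terms of a divergence-free
smooth `L²` slice `u` at a cut with low-mode factor `f_J` and smallness `κ`
(`∑_{|j|≤L} 4^j ‖N_j‖ ≤ B_f f_J F + B_κ κ D₄` for all `L` — `CheskidovDaiWeightedSum.lean`), finite data
`‖u‖₂ ≤ E₀`, `T₃(u) ≤ S₃`, and the absorption condition `B_κ κ C_r² d ≤ ν`:
`∑_{|j|≤L} 4^j (-ν ∑_i ‖∂_i Δ̇_j u‖²₂ - N_j) ≤ (B_κ κ C_r² 4^{-L} T_c).toReal + (B_f f_J).toReal · F(u).toReal`.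
[cite: CheskidovDai2015, §3.1 (3.8)] -/
theorem weighted_integrand_le_lowMode {u : EuclideanSpace ℝ ι → EuclideanSpace ℝ ι} (hu : IsSmoothL2Field u)
    {Bf Bκ κ fJ : ℝ≥0∞} {E₀ S₃ : ℝ≥0} {ν : ℝ} (hν : 0 ≤ ν)
    (hNL : ∀ L : ℕ, ∑ j ∈ Finset.Icc (-(L : ℤ)) L, (2 : ℝ≥0∞) ^ (2 * j) *
        ‖∫ x, ⟪blockFn j u x, blockFn j (convect u u) x⟫‖ₑ ≤
      Bf * (fJ * dyadicF u) + Bκ * (κ * dyadicSqSum (fun l => (2 : ℝ≥0∞) ^ l * blockL2 u l)))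
    (hE : eLpNorm u 2 volume ≤ E₀) (hS₃ : thirdSum u ≤ S₃)
    (hBf : Bf ≠ ∞) (hBκ : Bκ ≠ ∞) (hκ : κ ≠ ∞) (hfJ : fJ ≠ ∞) (hF : dyadicF u ≠ ∞)
    (hsmall : Bκ * κ * (K.Cr : ℝ≥0∞) ^ 2 * Fintype.card ι ≤ ENNReal.ofReal ν) (L : ℕ) :
    ∑ j ∈ Finset.Icc (-(L : ℤ)) L, (2 : ℝ) ^ (2 * j) *
        (-ν * (∑ i, ∫ x, ‖fderiv ℝ (blockFn j u) x (stdOrthonormalBasis ℝ (EuclideanSpace ℝ ι) i)‖ ^ 2) -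
          ∫ x, ⟪blockFn j u x, blockFn j (convect u u) x⟫) ≤
      (Bκ * κ * (K.Cr : ℝ≥0∞) ^ 2 * ((4⁻¹ : ℝ≥0∞) ^ L * K.cTail E₀ S₃)).toReal +
        (Bf * fJ).toReal * (dyadicF u).toReal := by
  set d : ℝ≥0∞ := (Fintype.card ι : ℝ≥0∞) with hd
  set Btail := Bκ * κ * (K.Cr : ℝ≥0∞) ^ 2 * ((4⁻¹ : ℝ≥0∞) ^ L * K.cTail E₀ S₃) with hBtail
  set X := truncDissip L u with hX
  set F := dyadicF u with hFdef
  set Ye := ∑ j ∈ Finset.Icc (-(L : ℤ)) L, (2 : ℝ≥0∞) ^ (2 * j) * ‖∫ x, ⟪blockFn j u x, blockFn j (convect u u) x⟫‖ₑ with hYe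
  -- Step 1: `ℝ≥0∞` bound with the dissipation absorbed
  have hD : dyadicD u ≤ d * X + (4⁻¹ : ℝ≥0∞) ^ L * K.cTail E₀ S₃ := by
    refine (K.dyadicD_le_sum_Icc_add hu L).trans ?_
    refine add_le_add (sum_Icc_blockGrad_sq_le_truncDissip L u) ?_
    rw [cTail]; gcongr
  have hmain : Ye ≤ ENNReal.ofReal ν * X + (Btail + Bf * fJ * F) := by
    calc Ye ≤ Bf * (fJ * F) + Bκ * (κ * dyadicSqSum (fun l => (2 : ℝ≥0∞) ^ l * blockL2 u l)) := hNL L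
      _ ≤ Bf * (fJ * F) + Bκ * (κ * ((K.Cr : ℝ≥0∞) ^ 2 * dyadicD u)) := by
          gcongr; exact dyadicSqSum_four_le_dyadicD K hu
      _ ≤ Bf * (fJ * F) + Bκ * (κ * ((K.Cr : ℝ≥0∞) ^ 2 * (d * X + (4⁻¹ : ℝ≥0∞) ^ L * K.cTail E₀ S₃))) := by gcongr
      _ = (Bκ * κ * (K.Cr : ℝ≥0∞) ^ 2 * d) * X + (Btail + Bf * fJ * F) := by rw [hBtail]; ring
      _ ≤ ENNReal.ofReal ν * X + (Btail + Bf * fJ * F) := by gcongr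
  -- finiteness
  have hXtop : X ≠ ∞ := truncDissip_ne_top hu L
  have hBtop : Btail ≠ ∞ := ENNReal.mul_ne_top (ENNReal.mul_ne_top (ENNReal.mul_ne_top hBκ hκ) (ENNReal.pow_ne_top ENNReal.coe_ne_top))
    (ENNReal.mul_ne_top (ENNReal.pow_ne_top (ENNReal.inv_ne_top.2 (by norm_num))) (K.cTail_ne_top E₀ S₃))
  have hKtop : Bf * fJ ≠ ∞ := ENNReal.mul_ne_top hBf hfJ
  have hYtop : Ye ≠ ∞ :=
    ENNReal.sum_ne_top.2 fun j _ => ENNReal.mul_ne_top (two_zpow_ne_top _) enorm_ne_top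
  have hνX : ENNReal.ofReal ν * X ≠ ∞ := ENNReal.mul_ne_top ENNReal.ofReal_ne_top hXtop
  -- Step 2: to the reals
  have hsplit : ∑ j ∈ Finset.Icc (-(L : ℤ)) L, (2 : ℝ) ^ (2 * j) *
        (-ν * (∑ i, ∫ x, ‖fderiv ℝ (blockFn j u) x (stdOrthonormalBasis ℝ (EuclideanSpace ℝ ι) i)‖ ^ 2) -
          ∫ x, ⟪blockFn j u x, blockFn j (convect u u) x⟫) =
      -ν * X.toReal + ∑ j ∈ Finset.Icc (-(L : ℤ)) L, (2 : ℝ) ^ (2 * j) * (-∫ x, ⟪blockFn j u x, blockFn j (convect u u) x⟫) := by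
    rw [hX, ← sum_Icc_dissip_eq_toReal hu L, Finset.mul_sum, ← Finset.sum_add_distrib]
    exact Finset.sum_congr rfl fun j _ => by ring
  have hYreal : ∑ j ∈ Finset.Icc (-(L : ℤ)) L, (2 : ℝ) ^ (2 * j) * (-∫ x, ⟪blockFn j u x, blockFn j (convect u u) x⟫) ≤
      ν * X.toReal + (Btail.toReal + (Bf * fJ).toReal * F.toReal) := by
    refine (sum_Icc_neg_nonlinear_le_toReal u L hYtop).trans ?_
    have := ENNReal.toReal_mono (ENNReal.add_ne_top.2 ⟨hνX, ENNReal.add_ne_top.2 ⟨hBtop, ENNReal.mul_ne_top hKtop hF⟩⟩) hmain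
    rw [ENNReal.toReal_add hνX (ENNReal.add_ne_top.2 ⟨hBtop, ENNReal.mul_ne_top hKtop hF⟩),
      ENNReal.toReal_add hBtop (ENNReal.mul_ne_top hKtop hF), ENNReal.toReal_mul (a := Bf * fJ), ENNReal.toReal_mul,
      ENNReal.toReal_ofReal hν] at this
    exact this
  rw [hsplit]
  have hX0 : 0 ≤ X.toReal := ENNReal.toReal_nonneg
  nlinarith [mul_nonneg hν hX0]

end SliceBound

/-! ## The two-point inequality along a smooth slab with a time-dependent cut -/

section Slab

open LPBounds

variable {ι : Type*} [Fintype ι] (K : LPBounds ι)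
variable {t₁ t₂ ν : ℝ} {v : ℝ → EuclideanSpace ℝ ι → EuclideanSpace ℝ ι} {p : ℝ → EuclideanSpace ℝ ι → ℝ}

/-- `x ≤ (ofReal x).toReal` for every real `x`. [folklore] -/
private theorem le_toReal_ofReal (x : ℝ) : x ≤ (ENNReal.ofReal x).toReal := by
  rw [ENNReal.toReal_ofReal']; exact le_max_left _ _

/-- `ofReal (∫ f) ≤ ∫⁻ ofReal f` for every real function (no integrability needed: a non-integrable `f`
has integral `0`). [folklore] -/
private theorem ofReal_integral_le_lintegral_ofReal' {α : Type*} [MeasurableSpace α] {μ : Measure α} (g : α → ℝ) :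
    ENNReal.ofReal (∫ x, g x ∂μ) ≤ ∫⁻ x, ENNReal.ofReal (g x) ∂μ := by
  by_cases hgi : Integrable g μ
  · have hmax : ∀ x, ENNReal.ofReal (max (g x) 0) = ENNReal.ofReal (g x) := by
      intro x
      rcases le_total (g x) 0 with hx | hx
      · rw [max_eq_right hx, ENNReal.ofReal_zero, ENNReal.ofReal_of_nonpos hx]
      · rw [max_eq_left hx]
    calc ENNReal.ofReal (∫ x, g x ∂μ) ≤ ENNReal.ofReal (∫ x, max (g x) 0 ∂μ) :=
          ENNReal.ofReal_le_ofReal (integral_mono hgi hgi.pos_part fun x => le_max_left _ _)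
      _ = ∫⁻ x, ENNReal.ofReal (max (g x) 0) ∂μ :=
          ofReal_integral_eq_lintegral_ofReal hgi.pos_part (Eventually.of_forall fun x => le_max_right _ _)
      _ = ∫⁻ x, ENNReal.ofReal (g x) ∂μ := lintegral_congr hmax
  · rw [integral_undef hgi, ENNReal.ofReal_zero]; exact bot_le

/-- **The two-point inequality for the dyadic energy with a low-mode rate** (the integrated form of
Cheskidov–Dai's (3.8) along a smooth slab solution, `H¹` version). GIVEN, at every time `τ ∈ [t₁, t₂]`,
the low-mode bound on the weighted nonlinear terms of the slice `v(τ)` at a cut `J(τ)` with a common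
smallness `κ` (`B_κ κ C_r² d ≤ ν`) and a bound `M_f` on the low-mode factors
`f_{J(τ)}(τ) = ∑_{n ≥ 0} 2^{J(τ)-n} ‖Δ̇_{J(τ)-n} v(τ)‖_∞`, then for `t₁ ≤ s ≤ t ≤ t₂`

  `F(v(t)) ≤ F(v(s)) + 2 (B_f ∫⁻_{(s,t]} f_{J(τ)}(τ) dτ) · sup_{[s,t]} F(v(·))`

(`toReal` throughout). The time integral is a lower Lebesgue integral: no measurability of `τ ↦ J(τ)`
(for Cheskidov–Dai, the dissipation wavenumber) is used. [cite: CheskidovDai2015, §3.1 (3.8)] -/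
theorem IsSmoothSlabSolution.dyadicF_two_point_lowMode (h : IsSmoothSlabSolution t₁ t₂ ν v p) (hν : 0 ≤ ν)
    {Bf Bκ κ : ℝ≥0∞} {E₀ S₁ S₃ Mf : ℝ≥0} {J : ℝ → ℤ}
    (hNL : ∀ τ ∈ Icc t₁ t₂, ∀ L : ℕ, ∑ j ∈ Finset.Icc (-(L : ℤ)) L, (2 : ℝ≥0∞) ^ (2 * j) *
        ‖∫ x, ⟪blockFn j (v τ) x, blockFn j (convect (v τ) (v τ)) x⟫‖ₑ ≤
      Bf * ((∑' n : ℕ, (2 : ℝ≥0∞) ^ (J τ - n) * blockSup (v τ) (J τ - n)) * dyadicF (v τ)) +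
        Bκ * (κ * dyadicSqSum (fun l => (2 : ℝ≥0∞) ^ l * blockL2 (v τ) l)))
    (hMf : ∀ τ ∈ Icc t₁ t₂, ∑' n : ℕ, (2 : ℝ≥0∞) ^ (J τ - n) * blockSup (v τ) (J τ - n) ≤ Mf)
    (hE : ∀ τ ∈ Icc t₁ t₂, eLpNorm (v τ) 2 volume ≤ E₀) (hS₁ : ∀ τ ∈ Icc t₁ t₂, gradSq (v τ) ≤ S₁)
    (hS₃ : ∀ τ ∈ Icc t₁ t₂, thirdSum (v τ) ≤ S₃) (hBf : Bf ≠ ∞) (hBκ : Bκ ≠ ∞) (hκ : κ ≠ ∞)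
    (hsmall : Bκ * κ * (K.Cr : ℝ≥0∞) ^ 2 * Fintype.card ι ≤ ENNReal.ofReal ν)
    {s t : ℝ} (hs' : t₁ ≤ s) (hst : s ≤ t) (ht : t ≤ t₂) :
    (dyadicF (v t)).toReal ≤ (dyadicF (v s)).toReal +
      2 * (Bf * ∫⁻ τ in Ioc s t, ∑' n : ℕ, (2 : ℝ≥0∞) ^ (J τ - n) * blockSup (v τ) (J τ - n)).toReal *
        sSup ((fun τ => (dyadicF (v τ)).toReal) '' Icc s t) := by
  set f : ℝ → ℝ := fun τ => (dyadicF (v τ)).toReal with hf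
  set fJ : ℝ → ℝ≥0∞ := fun τ => ∑' n : ℕ, (2 : ℝ≥0∞) ^ (J τ - n) * blockSup (v τ) (J τ - n) with hfJdef
  set Φ := sSup (f '' Icc s t) with hΦ
  set W := ∫⁻ τ in Ioc s t, fJ τ with hW
  have hsub : Icc s t ⊆ Icc t₁ t₂ := Icc_subset_Icc hs' ht
  have hsub' : Ioc s t ⊆ Icc t₁ t₂ := fun τ hτ => hsub ⟨hτ.1.le, hτ.2⟩
  -- finiteness of `F` on the slab and the supremum
  set Fmax : ℝ≥0∞ := 8 * (Fintype.card ι * ((K.Cr : ℝ≥0∞) ^ 2 * S₁)) with hFmax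
  have hFmax_top : Fmax ≠ ∞ := ENNReal.mul_ne_top (by norm_num) (ENNReal.mul_ne_top (ENNReal.natCast_ne_top _)
    (ENNReal.mul_ne_top (ENNReal.pow_ne_top ENNReal.coe_ne_top) ENNReal.coe_ne_top))
  have hFle : ∀ τ ∈ Icc t₁ t₂, dyadicF (v τ) ≤ Fmax := fun τ hτ =>
    dyadicF_le_of_gradSq_le K (h.smooth_slice τ hτ) (hS₁ τ hτ)
  have hFtop : ∀ τ ∈ Icc t₁ t₂, dyadicF (v τ) ≠ ∞ := fun τ hτ => ne_top_of_le_ne_top hFmax_top (hFle τ hτ)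
  have hfB : ∀ τ ∈ Icc t₁ t₂, f τ ≤ Fmax.toReal := fun τ hτ => ENNReal.toReal_mono hFmax_top (hFle τ hτ)
  have hbdd : BddAbove (f '' Icc s t) := ⟨Fmax.toReal, by rintro _ ⟨τ, hτ, rfl⟩; exact hfB τ (hsub hτ)⟩
  have hfΦ : ∀ τ ∈ Icc s t, f τ ≤ Φ := fun τ hτ => le_csSup hbdd ⟨τ, hτ, rfl⟩
  have hΦ0 : 0 ≤ Φ := le_csSup_of_le hbdd ⟨s, ⟨le_rfl, hst⟩, rfl⟩ ENNReal.toReal_nonneg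
  -- finiteness of the rate integral
  have hWle : W ≤ Mf * ENNReal.ofReal (t - s) := by
    calc W ≤ ∫⁻ _ in Ioc s t, (Mf : ℝ≥0∞) := setLIntegral_mono' measurableSet_Ioc fun τ hτ => hMf τ (hsub' hτ)
      _ = Mf * ENNReal.ofReal (t - s) := by rw [setLIntegral_const, Real.volume_Ioc, mul_comm]
  have hWtop : W ≠ ∞ := ne_top_of_le_ne_top (ENNReal.mul_ne_top ENNReal.coe_ne_top ENNReal.ofReal_ne_top) hWle
  have hfJtop : ∀ τ ∈ Icc t₁ t₂, fJ τ ≠ ∞ := fun τ hτ => ne_top_of_le_ne_top ENNReal.coe_ne_top (hMf τ hτ)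
  -- Step 1: the inequality at level `L`
  have hL : ∀ L : ℕ,
      (∑ j ∈ Finset.Icc (-(L : ℤ)) L, ((2 : ℝ≥0∞) ^ j * blockL2 (v t) j) ^ 2).toReal -
        (∑ j ∈ Finset.Icc (-(L : ℤ)) L, ((2 : ℝ≥0∞) ^ j * blockL2 (v s) j) ^ 2).toReal ≤
      2 * ((t - s) * (Bκ * κ * (K.Cr : ℝ≥0∞) ^ 2 * ((4⁻¹ : ℝ≥0∞) ^ L * K.cTail E₀ S₃)).toReal + (Bf * W).toReal * Φ) := by
    intro L
    set BL : ℝ := (Bκ * κ * (K.Cr : ℝ≥0∞) ^ 2 * ((4⁻¹ : ℝ≥0∞) ^ L * K.cTail E₀ S₃)).toReal with hBL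
    set I : ℝ → ℝ := fun τ => ∑ j ∈ Finset.Icc (-(L : ℤ)) L, (2 : ℝ) ^ (2 * j) *
        (-ν * (∑ i, ∫ x, ‖fderiv ℝ (blockFn j (v τ)) x (stdOrthonormalBasis ℝ (EuclideanSpace ℝ ι) i)‖ ^ 2) -
          ∫ x, ⟪blockFn j (v τ) x, blockFn j (convect (v τ) (v τ)) x⟫) with hI
    rw [← sum_Icc_energy_eq_toReal (h.smooth_slice t ⟨hs'.trans hst, ht⟩),
      ← sum_Icc_energy_eq_toReal (h.smooth_slice s ⟨hs', hst.trans ht⟩), h.weighted_blockEnergy_eq L hs' hst ht]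
    have hint : IntervalIntegrable I volume s t :=
      (IntervalIntegrable.sum (Finset.Icc (-(L : ℤ)) L) fun j _ =>
        (h.intervalIntegrable_rhs j hs' hst ht).const_mul ((2 : ℝ) ^ (2 * j))).congr fun τ _ => by
          simp only [hI, Finset.sum_apply]
    -- the pointwise bound
    have hptw : ∀ τ ∈ Icc s t, I τ ≤ BL + (Bf * fJ τ).toReal * f τ := by
      intro τ hτ
      have hτ' := hsub hτ
      exact weighted_integrand_le_lowMode K (h.smooth_slice τ hτ') hν (hNL τ hτ') (hE τ hτ') (hS₃ τ hτ')
        hBf hBκ hκ (hfJtop τ hτ') (hFtop τ hτ') hsmall L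
    -- integrate `I - BL` through the lower integral
    have hI1 : ∫ τ in s..t, I τ = (∫ τ in s..t, (I τ - BL)) + (t - s) * BL := by
      rw [intervalIntegral.integral_sub hint intervalIntegrable_const, intervalIntegral.integral_const, smul_eq_mul]
      ring
    have hI2 : ∫ τ in s..t, (I τ - BL) ≤ ((Bf * ENNReal.ofReal Φ) * W).toReal := by
      refine (le_toReal_ofReal _).trans (ENNReal.toReal_mono
        (ENNReal.mul_ne_top (ENNReal.mul_ne_top hBf ENNReal.ofReal_ne_top) hWtop) ?_)
      rw [intervalIntegral.integral_of_le hst]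
      refine (ofReal_integral_le_lintegral_ofReal' _).trans ?_
      rw [hW, ← lintegral_const_mul' _ _ (ENNReal.mul_ne_top hBf ENNReal.ofReal_ne_top)]
      refine setLIntegral_mono' measurableSet_Ioc fun τ hτ => ?_
      have hτ' : τ ∈ Icc s t := ⟨hτ.1.le, hτ.2⟩
      have h1 : I τ - BL ≤ (Bf * fJ τ).toReal * f τ := by linarith [hptw τ hτ']
      calc ENNReal.ofReal (I τ - BL) ≤ ENNReal.ofReal ((Bf * fJ τ).toReal * f τ) := ENNReal.ofReal_le_ofReal h1
        _ = Bf * fJ τ * ENNReal.ofReal (f τ) := by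
            rw [ENNReal.ofReal_mul ENNReal.toReal_nonneg, ENNReal.ofReal_toReal (ENNReal.mul_ne_top hBf (hfJtop τ (hsub hτ')))]
        _ ≤ Bf * fJ τ * ENNReal.ofReal Φ := by gcongr; exact hfΦ τ hτ'
        _ = Bf * ENNReal.ofReal Φ * fJ τ := by ring
    have hI3 : ((Bf * ENNReal.ofReal Φ) * W).toReal = (Bf * W).toReal * Φ := by
      rw [ENNReal.toReal_mul, ENNReal.toReal_mul, ENNReal.toReal_mul, ENNReal.toReal_ofReal hΦ0]; ring
    calc 2 * ∫ τ in s..t, I τ = 2 * ((∫ τ in s..t, (I τ - BL)) + (t - s) * BL) := by rw [hI1]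
      _ ≤ 2 * (((Bf * W).toReal * Φ) + (t - s) * BL) := by
          gcongr
          rw [← hI3]; exact hI2
      _ = 2 * ((t - s) * BL + (Bf * W).toReal * Φ) := by ring
  -- Step 2: `L → ∞`
  have hlimF : ∀ τ ∈ Icc t₁ t₂, Tendsto (fun L : ℕ => (∑ j ∈ Finset.Icc (-(L : ℤ)) L,
      ((2 : ℝ≥0∞) ^ j * blockL2 (v τ) j) ^ 2).toReal) atTop (𝓝 (f τ)) := fun τ hτ =>
    (ENNReal.tendsto_toReal (hFtop τ hτ)).comp (tendsto_sum_Icc_atTop _)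
  have hlimB : Tendsto (fun L : ℕ => (Bκ * κ * (K.Cr : ℝ≥0∞) ^ 2 * ((4⁻¹ : ℝ≥0∞) ^ L * K.cTail E₀ S₃)).toReal)
      atTop (𝓝 0) := by
    have h4 : Tendsto (fun L : ℕ => (4⁻¹ : ℝ≥0∞) ^ L) atTop (𝓝 0) :=
      ENNReal.tendsto_pow_atTop_nhds_zero_of_lt_one (by norm_num)
    have h5 : Tendsto (fun L : ℕ => (4⁻¹ : ℝ≥0∞) ^ L * K.cTail E₀ S₃) atTop (𝓝 (0 * K.cTail E₀ S₃)) :=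
      ENNReal.Tendsto.mul_const h4 (Or.inr (K.cTail_ne_top E₀ S₃))
    rw [zero_mul] at h5
    have h6 : Tendsto (fun L : ℕ => (Bκ * κ * (K.Cr : ℝ≥0∞) ^ 2) * ((4⁻¹ : ℝ≥0∞) ^ L * K.cTail E₀ S₃)) atTop
        (𝓝 ((Bκ * κ * (K.Cr : ℝ≥0∞) ^ 2) * 0)) :=
      ENNReal.Tendsto.const_mul h5 (Or.inr (ENNReal.mul_ne_top (ENNReal.mul_ne_top hBκ hκ)
        (ENNReal.pow_ne_top ENNReal.coe_ne_top)))
    rw [mul_zero] at h6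
    rw [← ENNReal.toReal_zero]
    exact (ENNReal.tendsto_toReal ENNReal.zero_ne_top).comp h6
  have hlim := le_of_tendsto_of_tendsto ((hlimF t ⟨hs'.trans hst, ht⟩).sub (hlimF s ⟨hs', hst.trans ht⟩))
    (((hlimB.const_mul (t - s)).add tendsto_const_nhds).const_mul 2) (Eventually.of_forall hL)
  rw [mul_zero, zero_add] at hlim
  rw [hf] at hlim
  simp only at hlim
  linarith [hlim]

end Slab

end Literature.Analysis.FluidPDE

end
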